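import Literature.NumberTheory.Automorphic.Sweep1PotentialModularity
import Literature.NumberTheory.EllipticCurves.HasseWeilGoodReduction
import Literature.NumberTheory.EllipticCurves.HasseWeilAbelianUnramifiedProofs
import Literature.NumberTheory.EllipticCurves.TateModuleContinuityProofs
import Literature.NumberTheory.EllipticCurves.TateModuleFinite
import HarnessLib

/-!
# Potential modularity of elliptic curves over CM fields (lang.S28): reduction to the source and
the Euler factors at the places of good reduction

Pure-proof sibling of `Literature.NumberTheory.Automorphic.Sweep1PotentialModularity` and
`Sweep1PotentialModularityProofs` (namespace `Literature.Lang`), landed by the tenured seat of the named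
fact `Literature.NumberTheory.Automorphic.exists_isCMField_isModular` (**lang.S28**; Allen–Calegari–Caraiani–Gee–Helm–
Le Hung–Newton–Scholze–Taylor–Thorne, *Potential automorphy over CM fields*, Ann. of Math. 197
(2023), Thm. 1.0.1).  `Sweep1PotentialModularityProofs` reduced the `Sweep1` transcription of
lang.S28 to the source in Galois form (Cor. 7.1.12 for `R_E`, an explicit hypothesis: the former
named fact `exists_isCMField_isTateAutomorphic`, merged back into the obligation
`exists_isCMField_isModular` by the review of 2026-08-15, D-0026) and one named fact,
`WeierstrassCurve.hasseWeilEulerFactor_geomPoints` — the Euler factors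
`det(1 - σ_v T | (V_ℓ E)_{I_v})` of the Tate module at *every* place `v ∤ ℓ`, whose content at the
places of bad reduction (`1 ∓ T` via Tate curves, `1` via `(V_ℓ E)^{I_v} = 0` for additive
reduction) is never used: `WeierstrassCurve.IsModular` is an `∀ᶠ v in cofinite` statement and an
elliptic curve has good reduction at all but finitely many places
(`WeierstrassCurve.finite_badPlaces_holds`, `DiophantineGeometry/LocalReductionFiniteBadPlacesProofs`,
restated as `WeierstrassCurve.eventually_hasGoodReductionAt` in
`EllipticCurves/HasseWeilGoodReduction`; Silverman, *AEC*, Rem. VIII.1.3).  This file records the sharper reduction: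

* `WeierstrassCurve.IsTateAutomorphic.isModular_of_eventually_eulerFactor` (**proved**): the
  engine `IsTateAutomorphic.isModular` of the parent with the Euler-factor hypothesis required
  only at all but finitely many `v ∤ ℓ`;
* `WeierstrassCurve.IsTateAutomorphic.isModular_of_hasGoodReduction` (**proved**): a
  Tate-automorphic elliptic curve is modular (`WeierstrassCurve.IsModular`) given only the named
  fact `WeierstrassCurve.hasseWeilEulerFactor_of_hasGoodReduction` (`HasseWeilGoodReduction`: the
  Euler factor at a place `v ∤ ℓ` of good reduction is `1 - a_v T + q_v T²`; Silverman
  Prop. VII.4.1(b), Thm. V.2.3.1, C.§16 — the easy direction of Néron–Ogg–Shafarevich and the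
  trace of Frobenius on `T_ℓ Ẽ_v`); the parent's `isModular_of_eulerFactor` is the special case
  `h₁ := hasseWeilEulerFactor_of_hasGoodReduction_of_geomPoints W ℓ h`;
* `Literature.NumberTheory.Automorphic.exists_isCMField_isModular_of_isTateAutomorphic_of_hasGoodReduction` (**proved**):
  the Galois-side statement of the source (hypothesis) and
  `hasseWeilEulerFactor_of_hasGoodReduction` (for all elliptic curves over number fields, at one
  prime `ℓ`) imply `Literature.NumberTheory.Automorphic.exists_isCMField_isModular`.

Hence the accepted formulation of lang.S28 in `Sweep1` rests on the source's Cor. 7.1.12 for `R_E`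
(the whole of the source; the obligation `exists_isCMField_isModular` itself) and one named fact,
the Euler factors of `V_ℓ E` at the places of good reduction.

## References

* P. B. Allen, F. Calegari, A. Caraiani, T. Gee, D. Helm, B. V. Le Hung, J. Newton, P. Scholze,
  R. Taylor, J. A. Thorne, *Potential automorphy over CM fields*, Ann. of Math. (2) 197 (2023),
  897–1113: Thm. 1.0.1, §7.1, Cor. 7.1.12. [AllenCalegariCaraianiGeeEtAl2023]
* J. H. Silverman, *The Arithmetic of Elliptic Curves*, 2nd ed., GTM 106 (2009), Prop. VII.4.1,
  Thm. V.2.3.1, Rem. VIII.1.3, C.§16. [SilvermanAEC2009]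
-/

open scoped MatrixGroups Polynomial NumberField
open NumberField IsDedekindDomain MeasureTheory Filter Polynomial

namespace Literature.NumberTheory.Automorphic


/-- **From the Galois form to `Sweep1`'s automorphic form: the Euler factors are needed only at
almost all places.**  Generalisation of `WeierstrassCurve.IsTateAutomorphic.isModular`
(`Sweep1PotentialModularity`) in which the Euler-factor hypothesis `h₁`
(`hasseWeilEulerFactor_geomPoints`: `L_v(V_ℓ E, T) = L_v(E, T)` at *every* `v ∤ ℓ`) is weakened
to the same identity at all but finitely many `v ∤ ℓ` — which is all the proof uses, since
`WeierstrassCurve.IsModular` is an `∀ᶠ v in cofinite` statement.  Proof: verbatim that of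
`IsTateAutomorphic.isModular`, intersecting one more cofinite set.  Silverman, *AEC*, V.2.3.1 and
C.§16 (`L_v(E, T) = 1 - a_v T + q_v T²`, `a_v` the trace of Frobenius).
[cite: SilvermanAEC2009, Thm. V.2.3.1 and C.§16] -/
theorem _root_.WeierstrassCurve.IsTateAutomorphic.isModular_of_eventually_eulerFactor {F : Type}
    [Field F] [NumberField F] {W : WeierstrassCurve F} [W.IsElliptic] (hW : W.IsTateAutomorphic)
    (ℓ : ℕ) [Fact ℓ.Prime] (hcont : W.continuous_rationalGaloisRepTate ℓ)
    (hfin : W.module_finite_rationalTateModule ℓ)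
    (h₁ : ∀ᶠ v : HeightOneSpectrum (𝓞 F) in cofinite,
      ∀ (h : Continuous fun x : Field.absoluteGaloisGroup F × W.rationalTateModule ℓ =>
          EllipticCurves.rationalTateRepresentation (Field.absoluteGaloisGroup F) (WeierstrassCurve.geomPoints W)
            ℓ x.1 x.2)
        (hfin : Module.Finite ℚ_[ℓ] (W.rationalTateModule ℓ)), (ℓ : 𝓞 F) ∉ v.asIdeal →
        (haveI := hfin; EllipticCurves.hasseWeilEulerFactor (WeierstrassCurve.geomPoints W) ℓ h v) =
          (W.localPolynomialAt v).map (Int.castRingHom ℚ_[ℓ]))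
    (h₂ : EllipticCurves.hasseWeilEulerFactor_eq_reverse_frobCharpoly (K := F) (WeierstrassCurve.geomPoints W) ℓ) :
    W.IsModular := by
  obtain ⟨μ, hμ, P, 𝔫, h𝔫, hev⟩ := hW
  refine ⟨μ, hμ, P, 𝔫, h𝔫, ?_⟩
  filter_upwards [hev, eventually_natCast_not_mem_asIdeal F (Fact.out : ℓ.Prime).ne_zero, h₁]
    with v hv hvℓ hv₁
  obtain ⟨hv𝔫, ϖ, α, a, hSat, hpoly, hGal⟩ := hv
  refine ⟨hv𝔫, ϖ, α, hSat, ?_⟩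
  -- the Galois side at the auxiliary prime `ℓ`
  haveI hfinI : Module.Finite ℚ_[ℓ] (W.rationalTateModule ℓ) := hfin
  have hc : Continuous fun x : Field.absoluteGaloisGroup F × W.rationalTateModule ℓ =>
      EllipticCurves.rationalTateRepresentation (Field.absoluteGaloisGroup F)
        (WeierstrassCurve.geomPoints W) ℓ x.1 x.2 := hcont
  obtain ⟨hunr, hFrob⟩ := hGal ℓ hvℓ hc hfinI
  -- the Frobenius characteristic polynomial of `V_ℓ E` at `v` is `X² - a X + q_v`
  have hfc : (EllipticCurves.rationalTateGaloisRepOf (WeierstrassCurve.geomPoints W) ℓ hc).frobCharpoly v =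
      (frobPoly a v.residueCard).map (Int.castRingHom ℚ_[ℓ]) := by
    have h' := GaloisRepresentations.GaloisRep.hasFrobCharpolyAt_frobCharpoly_of_exists ⟨_, hFrob⟩
    obtain ⟨𝔓, h𝔓⟩ := HeightOneSpectrum.primesAbove_nonempty v
    obtain ⟨σ, hσ⟩ := HeightOneSpectrum.exists_isArithFrobAt_of_mem_primesAbove_holds h𝔓
    rw [← h' 𝔓 h𝔓 σ hσ, ← hFrob 𝔓 h𝔓 σ hσ]
  -- the Euler factor of `V_ℓ E` at `v`, computed in two ways, gives `L_v(E, T) = 1 - a T + q T²`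
  have hE₁ := hv₁ hc hfinI hvℓ
  have hE₂ := h₂ hc hunr
  have hloc : W.localPolynomialAt v = eulerPoly a v.residueCard := by
    apply Polynomial.map_injective (Int.castRingHom ℚ_[ℓ]) (RingHom.injective_int _)
    rw [← hE₁, hE₂, hfc, reverse_map_frobPoly]
  -- the automorphic side: `α = {z₁, z₂}` with `√q z₁ + √q z₂ = a` and `(√q z₁)(√q z₂) = q`
  obtain ⟨z₁, z₂, rfl⟩ := Multiset.card_eq_two.1 hSat.card_eq
  set c : ℂ := ((Real.sqrt (v.residueCard : ℝ) : ℝ) : ℂ) with hc_def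
  have hpoly' : (X : ℂ[X]) ^ 2 - Polynomial.C (c * z₁ + c * z₂) * X +
        Polynomial.C (c * z₁ * (c * z₂)) =
      X ^ 2 - Polynomial.C (a : ℂ) * X + Polynomial.C ((v.residueCard : ℕ) : ℂ) := by
    rw [← X_sub_C_mul_X_sub_C]
    simpa [frobPoly, Polynomial.map_sub, Polynomial.map_add, Polynomial.map_mul,
      Polynomial.map_pow] using hpoly
  obtain ⟨hsum, hprod⟩ := coeff_quadratic_eq hpoly'
  change (W.localPolynomialAt v).map (Int.castRingHom ℂ) = _
  rw [hloc, Multiset.insert_eq_cons, Multiset.map_cons, Multiset.prod_cons, Multiset.map_singleton,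
    Multiset.prod_singleton, one_sub_mul_one_sub, hsum, hprod]
  simp [eulerPoly, Polynomial.map_sub, Polynomial.map_add, Polynomial.map_mul, Polynomial.map_pow]

/-- **From the Galois form to `Sweep1`'s automorphic form, given only the Euler factors at the
places of good reduction.**  A Tate-automorphic elliptic curve over a number field is modular in
the sense of `WeierstrassCurve.IsModular` (`Sweep1`), given at one auxiliary prime `ℓ` the named
fact `WeierstrassCurve.hasseWeilEulerFactor_of_hasGoodReduction` (`HasseWeilGoodReduction`):
`det(1 - σ_v T | (V_ℓ E)_{I_v}) = 1 - a_v T + q_v T²` at the places `v ∤ ℓ` of good reduction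
(Silverman VII.4.1(b), V.2.3.1, C.§16).  The places of bad reduction are finite in number
(`WeierstrassCurve.eventually_hasGoodReductionAt`, i.e. `finite_badPlaces_holds`; Silverman
Rem. VIII.1.3) and are discarded; continuity and finite-dimensionality of `V_ℓ E` and the unramified Euler-factor
comparison are the theorems `continuous_rationalGaloisRepTate_holds`,
`module_finite_rationalTateModule_holds`, `hasseWeilEulerFactor_eq_reverse_frobCharpoly_holds`.
[cite: SilvermanAEC2009, Prop. VII.4.1(b), Thm. V.2.3.1 and C.§16] -/
theorem _root_.WeierstrassCurve.IsTateAutomorphic.isModular_of_hasGoodReduction {F : Type}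
    [Field F] [NumberField F] {W : WeierstrassCurve F} [W.IsElliptic] (hW : W.IsTateAutomorphic)
    (ℓ : ℕ) [Fact ℓ.Prime] (h₁ : W.hasseWeilEulerFactor_of_hasGoodReduction ℓ) : W.IsModular :=
  hW.isModular_of_eventually_eulerFactor ℓ (W.continuous_rationalGaloisRepTate_holds ℓ)
    (W.module_finite_rationalTateModule_holds ℓ)
    (W.eventually_hasseWeilEulerFactor_eq_localPolynomialAt ℓ h₁)
    (EllipticCurves.hasseWeilEulerFactor_eq_reverse_frobCharpoly_holds (K := F) (WeierstrassCurve.geomPoints W) ℓ)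

/-- **lang.S28 (`Sweep1` form) from the source and the Euler factors at the places of good
reduction.**  The Galois-side statement of the source (Allen–Calegari–Caraiani–Gee–Helm–Le Hung–
Newton–Scholze–Taylor–Thorne, Ann. of Math. 197 (2023), Cor. 7.1.12 for `R_E`, i.e. Thm. 1.0.1 for
a non-CM `E`: over a finite Galois CM extension `F'/F`, `E ×_F F'` is Tate-automorphic — the
explicit hypothesis `hACC`, formerly the named fact `exists_isCMField_isTateAutomorphic`, merged
back 2026-08-15) together with, at one prime `ℓ` and for all elliptic curves over
number fields, the Euler factors of `V_ℓ E` at the places `v ∤ ℓ` of good reduction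
(`WeierstrassCurve.hasseWeilEulerFactor_of_hasGoodReduction`; Silverman VII.4.1(b), V.2.3.1,
C.§16) implies `Literature.NumberTheory.Automorphic.exists_isCMField_isModular`: every elliptic curve without geometric CM
over a CM field becomes modular (`WeierstrassCurve.IsModular`) over a finite CM extension.  Hence
the accepted formulation of lang.S28 in `Sweep1` rests on the source and one named fact, the
criterion of Néron–Ogg–Shafarevich (easy direction) with the trace of Frobenius on `T_ℓ Ẽ_v` at
the good places.
[cite: AllenCalegariCaraianiGeeEtAl2023, Thm. 1.0.1 (non-CM case), via Cor. 7.1.12] -/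
theorem exists_isCMField_isModular_of_isTateAutomorphic_of_hasGoodReduction (ℓ : ℕ) [Fact ℓ.Prime]
    (hACC : ∀ {F : Type} [Field F] [NumberField F] [IsCMField F] (W : WeierstrassCurve F)
      [W.IsElliptic] (_hW : ¬ W.HasCM),
      ∃ (F' : Type) (_ : Field F') (_ : NumberField F') (_ : Algebra F F'),
        IsCMField F' ∧ IsGalois F F' ∧ (W.baseChange F').IsTateAutomorphic)
    (h₁ : ∀ {K : Type} [Field K] [NumberField K] (W : WeierstrassCurve K) [W.IsElliptic],
      W.hasseWeilEulerFactor_of_hasGoodReduction ℓ) :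
    exists_isCMField_isModular := by
  intro F _ _ _ W _ hW
  obtain ⟨F', _, _, _, hCM, _, hT⟩ := hACC W hW
  haveI : (W.baseChange F').IsElliptic := by
    dsimp only [WeierstrassCurve.baseChange]
    infer_instance
  exact ⟨F', _, _, _, hCM, hT.isModular_of_hasGoodReduction ℓ (h₁ _)⟩

end Literature.NumberTheory.Automorphic
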